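import Mathlib

/-! # `Balaban1983to89.B12ZetaWitness` — the printed constant `5` for the cut-off `ζ` of [I] §3 p. 270 is impossible (kernel witness for GAPS G-adv9-1)

CITATION HEADER.  Cell pub-balaban, unit b2b-balaban-b12-g5 (PAPER SUB-CELL B12 gen 5), journal claim
G-adv9-1-KERNEL.  Source: T. Bałaban, *Renormalization group approach to lattice gauge field theories. I. Generation of
effective actions in a small field approximation and a coupling constant renormalization in four dimensions*, Commun.
Math. Phys. 109 (1987) 249–301 [`Balaban1987RG1`], §3 p. 270 [PDF 22], the paragraph introducing the partition of
unity below (3.1) (render `b2b-balaban-ref1/pages/1987-cmp109-rg-I-small-field/…-p022-x2.png`, read as an image).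
VERBATIM: *"Let us take the partition π_k. We construct a cover of the space T by cubes □, which are unions of 2^d
neighbouring cubes from π_k. For this cover we take a partition of unity 1 = Σ_□ ζ_□ with smooth functions ζ_□. More
exactly we assume that if y is a center of the cube □, then ζ_□(x) = Π_{μ=1}^{d} ζ(M⁻¹(x_μ − y_μ)), where
ζ ∈ C₀^∞(R¹), ζ(t) = 1 for |t| ≦ 1/3, ζ(t) = 0 for |t| ≧ 2/3, ζ has derivatives up to the second order bounded by 5."*

THE OBJECTION (GAPS G-adv9-1, adversarial reader adv9; weight nil — no consumer of the literal `5` was located in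
[I] §§3–5, where the second derivative of ζ_□ enters only through `M⁻²·const`, absorbed in "M large"): no such ζ
exists.  On the transition interval [1/3, 2/3] the function must drop from 1 to 0 while its first derivative vanishes
at both ends (ζ is constant to the left of 1/3 and to the right of 2/3), and a second derivative bounded by K only
allows |ζ′(t)| ≤ K·min(t − 1/3, 2/3 − t); hence 1 ≤ K/36, i.e. every admissible ζ has sup|ζ″| ≥ 36 > 5.  REPAIR (as
recorded in G-adv9-1): replace "5" by any constant ≥ 36 for the second derivative (the first-derivative bound 5 is
consistent: only sup|ζ′| ≥ 3 is forced, `three_le_of_abs_deriv_le`).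

WHAT IS KERNEL-CHECKED HERE (value = kernel certificate of a located objection to a printed auxiliary constant,
NOT summit progress; nothing of [I] is asserted — the hypotheses below ARE the printed properties of ζ, and the
conclusion refutes the printed bound):
* `deriv_eq_zero_on_closure` — a differentiable function that is constant on an open set has zero derivative on the
  closure of that set, provided the derivative is continuous (uniqueness of the derivative + `Set.EqOn.closure`);
* `abs_deriv_le_mul_abs_sub` — if ζ′(a) = 0 and |ζ″| ≤ K everywhere then |ζ′(t)| ≤ K·|t − a| (mean value
  inequality `Convex.norm_image_sub_le_of_norm_hasDerivWithin_le`);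
* `monotoneOn_Ici_add_sq` / `monotoneOn_Iic_sub_sq` — under that bound, t ↦ ζ(t) + (K/2)(t − a)² is monotone on
  [a, ∞) and t ↦ ζ(t) − (K/2)(t − a)² is monotone on (−∞, a] (`monotoneOn_of_hasDerivWithinAt_nonneg`), i.e. the
  two one-sided Taylor estimates at t = 1/2 without integrals;
* `thirtySix_le` — MAIN: for ζ, ζ′, ζ″ : ℝ → ℝ with `HasDerivAt ζ (ζ′ t) t`, `HasDerivAt ζ′ (ζ″ t) t` for all t,
  ζ = 1 on |t| ≤ 1/3, ζ = 0 on |t| ≥ 2/3 and |ζ″| ≤ K everywhere: 36 ≤ K (from 1 = ζ(1/3) ≤ ζ(1/2) + K/72 and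
  ζ(1/2) − K/72 ≤ ζ(2/3) = 0);
* `thirtySix_le_of_contDiff` — the same for `ContDiff ℝ 2 ζ` with `iteratedDeriv 2 ζ` (so a fortiori for
  ζ ∈ C₀^∞); `not_exists_printed_zeta` — the printed specification with the constant 5 on the second derivative has
  no inhabitant; `three_le_of_abs_deriv_le` — the (harmless) necessary bound 3 ≤ sup|ζ′|.
(36 is the infimum of sup|ζ″| over admissible C² profiles and is not attained — the extremal profile has ζ″ = ∓36
switching sign at t = 1/2; this sharpness remark is NOT checked here and nothing uses it.)
LEAVES: none (pure one-variable calculus over Mathlib).  Elementary; [folklore] throughout. -/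

namespace Literature.MathematicalPhysics.QuantumFieldTheory.Balaban1983to89.B12ZetaWitness

open Set

/-! ## Two calculus lemmas -/

/-- A function with a derivative everywhere and a continuous derivative, constant on an open set `s`, has zero
derivative on `closure s`. [folklore] -/
theorem deriv_eq_zero_on_closure {f f' : ℝ → ℝ} {s : Set ℝ} {c : ℝ} (hs : IsOpen s)
    (h1 : ∀ t, HasDerivAt f (f' t) t) (hf' : Continuous f') (hc : ∀ t ∈ s, f t = c) :
    ∀ t ∈ closure s, f' t = 0 := by
  have h0 : EqOn f' (fun _ => (0 : ℝ)) s := by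
    intro t ht
    have hev : f =ᶠ[nhds t] fun _ => c := Filter.eventuallyEq_of_mem (hs.mem_nhds ht) (fun x hx => hc x hx)
    have hd : HasDerivAt f 0 t := (hasDerivAt_const t c).congr_of_eventuallyEq hev
    exact (h1 t).unique hd
  exact h0.closure hf' continuous_const

/-- If `f′ a = 0` and `|f″| ≤ K` everywhere, then `|f′ t| ≤ K · |t − a|` (mean value inequality). [folklore] -/
theorem abs_deriv_le_mul_abs_sub {f' f'' : ℝ → ℝ} {K a : ℝ}
    (h2 : ∀ t, HasDerivAt f' (f'' t) t) (hK : ∀ t, |f'' t| ≤ K) (ha : f' a = 0) (t : ℝ) :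
    |f' t| ≤ K * |t - a| := by
  have h := Convex.norm_image_sub_le_of_norm_hasDerivWithin_le (f := f') (f' := f'') (s := Set.univ)
    (x := a) (y := t) (C := K) (fun x _ => (h2 x).hasDerivWithinAt)
    (fun x _ => by rw [Real.norm_eq_abs]; exact hK x) convex_univ (mem_univ _) (mem_univ _)
  rw [ha, sub_zero, Real.norm_eq_abs, Real.norm_eq_abs] at h
  exact h

/-! ## One-sided second-order Taylor estimates, integral-free -/

/-- If `|f′ t| ≤ K |t − a|` for all `t`, then `t ↦ f t + (K/2)(t − a)²` is monotone on `[a, ∞)`. [folklore] -/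
theorem monotoneOn_Ici_add_sq {f f' : ℝ → ℝ} {K a : ℝ} (h1 : ∀ t, HasDerivAt f (f' t) t)
    (hb : ∀ t, |f' t| ≤ K * |t - a|) :
    MonotoneOn (fun t => f t + K / 2 * ((t - a) * (t - a))) (Ici a) := by
  have hd : ∀ t, HasDerivAt (fun t => f t + K / 2 * ((t - a) * (t - a))) (f' t + K * (t - a)) t := by
    intro t
    have hp : HasDerivAt (fun x : ℝ => (x - a) * (x - a)) (1 * (t - a) + (t - a) * 1) t :=
      ((hasDerivAt_id t).sub_const a).mul ((hasDerivAt_id t).sub_const a)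
    exact ((h1 t).add (hp.const_mul (K / 2))).congr_deriv (by ring)
  have hc : Continuous (fun t => f t + K / 2 * ((t - a) * (t - a))) :=
    continuous_iff_continuousAt.2 fun t => (hd t).continuousAt
  refine monotoneOn_of_hasDerivWithinAt_nonneg (convex_Ici a) hc.continuousOn
    (fun t _ => (hd t).hasDerivWithinAt) ?_
  intro t ht
  rw [interior_Ici] at ht
  have ht' : a < t := ht
  have hbt := hb t
  rw [abs_of_pos (sub_pos.2 ht')] at hbt
  have := (abs_le.1 hbt).1
  linarith

/-- If `|f′ t| ≤ K |t − a|` for all `t`, then `t ↦ f t − (K/2)(t − a)²` is monotone on `(−∞, a]`. [folklore] -/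
theorem monotoneOn_Iic_sub_sq {f f' : ℝ → ℝ} {K a : ℝ} (h1 : ∀ t, HasDerivAt f (f' t) t)
    (hb : ∀ t, |f' t| ≤ K * |t - a|) :
    MonotoneOn (fun t => f t - K / 2 * ((t - a) * (t - a))) (Iic a) := by
  have hd : ∀ t, HasDerivAt (fun t => f t - K / 2 * ((t - a) * (t - a))) (f' t - K * (t - a)) t := by
    intro t
    have hp : HasDerivAt (fun x : ℝ => (x - a) * (x - a)) (1 * (t - a) + (t - a) * 1) t :=
      ((hasDerivAt_id t).sub_const a).mul ((hasDerivAt_id t).sub_const a)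
    exact ((h1 t).sub (hp.const_mul (K / 2))).congr_deriv (by ring)
  have hc : Continuous (fun t => f t - K / 2 * ((t - a) * (t - a))) :=
    continuous_iff_continuousAt.2 fun t => (hd t).continuousAt
  refine monotoneOn_of_hasDerivWithinAt_nonneg (convex_Iic a) hc.continuousOn
    (fun t _ => (hd t).hasDerivWithinAt) ?_
  intro t ht
  rw [interior_Iic] at ht
  have ht' : t < a := ht
  have hbt := hb t
  rw [abs_of_neg (sub_neg.2 ht')] at hbt
  have := (abs_le.1 hbt).1
  linarith

/-! ## The witness -/

/-- **MAIN.**  A twice differentiable `ζ : ℝ → ℝ` with `ζ = 1` on `|t| ≤ 1/3`, `ζ = 0` on `|t| ≥ 2/3` and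
`|ζ″| ≤ K` everywhere has `36 ≤ K`; in particular the printed "derivatives up to the second order bounded by 5"
([I] p. 270) is impossible.  Refutes a printed auxiliary constant; asserts nothing of [I]. [folklore] -/
theorem thirtySix_le {ζ ζ' ζ'' : ℝ → ℝ} {K : ℝ}
    (h1 : ∀ t, HasDerivAt ζ (ζ' t) t) (h2 : ∀ t, HasDerivAt ζ' (ζ'' t) t)
    (hone : ∀ t, |t| ≤ 1 / 3 → ζ t = 1) (hzero : ∀ t, 2 / 3 ≤ |t| → ζ t = 0)
    (hK : ∀ t, |ζ'' t| ≤ K) : 36 ≤ K := by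
  have hζ'c : Continuous ζ' := continuous_iff_continuousAt.2 fun t => (h2 t).continuousAt
  -- ζ′(1/3) = 0 and ζ′(2/3) = 0 by continuity of ζ′
  have hA : ζ' (1 / 3) = 0 := by
    refine deriv_eq_zero_on_closure (s := Ioo (-(1 / 3)) (1 / 3)) (c := 1) isOpen_Ioo h1 hζ'c
      (fun t ht => hone t (abs_le.2 ⟨ht.1.le, ht.2.le⟩)) _ ?_
    rw [closure_Ioo (by norm_num)]
    exact ⟨by norm_num, le_rfl⟩
  have hB : ζ' (2 / 3) = 0 := by
    refine deriv_eq_zero_on_closure (s := Ioi (2 / 3)) (c := 0) isOpen_Ioi h1 hζ'c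
      (fun t ht => hzero t ?_) _ ?_
    · have ht' : (2 : ℝ) / 3 < t := ht
      rw [abs_of_pos (by linarith)]
      exact ht'.le
    · rw [closure_Ioi]
      exact self_mem_Ici
  -- |ζ′ t| ≤ K (t − 1/3) to the right of 1/3, |ζ′ t| ≤ K (2/3 − t) to the left of 2/3
  have hL : ∀ t, |ζ' t| ≤ K * |t - 1 / 3| := abs_deriv_le_mul_abs_sub h2 hK hA
  have hR : ∀ t, |ζ' t| ≤ K * |t - 2 / 3| := abs_deriv_le_mul_abs_sub h2 hK hB
  -- one-sided Taylor estimates at t = 1/2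
  have h13 : (1 : ℝ) / 3 ∈ Ici (1 / 3 : ℝ) := self_mem_Ici
  have h12 : (1 : ℝ) / 2 ∈ Ici (1 / 3 : ℝ) := by norm_num [mem_Ici]
  have hup := monotoneOn_Ici_add_sq h1 hL h13 h12 (by norm_num)
  have h12' : (1 : ℝ) / 2 ∈ Iic (2 / 3 : ℝ) := by norm_num [mem_Iic]
  have h23 : (2 : ℝ) / 3 ∈ Iic (2 / 3 : ℝ) := self_mem_Iic
  have hdown := monotoneOn_Iic_sub_sq h1 hR h12' h23 (by norm_num)
  simp only at hup hdown
  have e13 : ζ (1 / 3) = 1 := hone _ (by rw [abs_of_pos (by norm_num)])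
  have e23 : ζ (2 / 3) = 0 := hzero _ (by rw [abs_of_pos (by norm_num)])
  rw [e13] at hup
  rw [e23] at hdown
  nlinarith [hup, hdown]

/-- The same for `ζ ∈ C²` stated with `ContDiff ℝ 2` and `iteratedDeriv 2` (a fortiori for `ζ ∈ C₀^∞(ℝ)`). [folklore] -/
theorem thirtySix_le_of_contDiff {ζ : ℝ → ℝ} {K : ℝ} (hζ : ContDiff ℝ 2 ζ)
    (hone : ∀ t, |t| ≤ 1 / 3 → ζ t = 1) (hzero : ∀ t, 2 / 3 ≤ |t| → ζ t = 0)
    (hK : ∀ t, |iteratedDeriv 2 ζ t| ≤ K) : 36 ≤ K := by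
  have hd1 : Differentiable ℝ ζ := hζ.differentiable (by norm_num)
  have hd2 : Differentiable ℝ (deriv ζ) := hζ.differentiable_deriv_two
  have hK' : ∀ t, |deriv (deriv ζ) t| ≤ K := by
    intro t
    have := hK t
    rwa [show (2 : ℕ) = 1 + 1 from rfl, iteratedDeriv_succ, iteratedDeriv_one] at this
  exact thirtySix_le (fun t => (hd1 t).hasDerivAt) (fun t => (hd2 t).hasDerivAt) hone hzero hK'

/-- **The printed specification has no inhabitant**: there is no `C²` (let alone `C₀^∞`) function with `ζ = 1` on
`|t| ≤ 1/3`, `ζ = 0` on `|t| ≥ 2/3` and second derivative bounded by `5` ([I] p. 270; GAPS G-adv9-1). [folklore] -/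
theorem not_exists_printed_zeta :
    ¬ ∃ ζ : ℝ → ℝ, ContDiff ℝ 2 ζ ∧ (∀ t, |t| ≤ 1 / 3 → ζ t = 1) ∧ (∀ t, 2 / 3 ≤ |t| → ζ t = 0) ∧
      ∀ t, |iteratedDeriv 2 ζ t| ≤ 5 := by
  rintro ⟨ζ, hζ, hone, hzero, h5⟩
  have := thirtySix_le_of_contDiff hζ hone hzero h5
  norm_num at this

/-- The first-derivative half of the printed sentence is consistent: only `3 ≤ sup |ζ′|` is forced (mean value
inequality between `t = 1/3` and `t = 2/3`). [folklore] -/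
theorem three_le_of_abs_deriv_le {ζ ζ' : ℝ → ℝ} {K₁ : ℝ} (h1 : ∀ t, HasDerivAt ζ (ζ' t) t)
    (hone : ∀ t, |t| ≤ 1 / 3 → ζ t = 1) (hzero : ∀ t, 2 / 3 ≤ |t| → ζ t = 0)
    (hK : ∀ t, |ζ' t| ≤ K₁) : 3 ≤ K₁ := by
  have h := Convex.norm_image_sub_le_of_norm_hasDerivWithin_le (f := ζ) (f' := ζ') (s := Set.univ)
    (x := (1 : ℝ) / 3) (y := (2 : ℝ) / 3) (C := K₁) (fun x _ => (h1 x).hasDerivWithinAt)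
    (fun x _ => by rw [Real.norm_eq_abs]; exact hK x) convex_univ (mem_univ _) (mem_univ _)
  have e13 : ζ (1 / 3) = 1 := hone _ (by rw [abs_of_pos (by norm_num)])
  have e23 : ζ (2 / 3) = 0 := hzero _ (by rw [abs_of_pos (by norm_num)])
  rw [e13, e23, Real.norm_eq_abs, Real.norm_eq_abs] at h
  norm_num at h
  linarith

end Literature.MathematicalPhysics.QuantumFieldTheory.Balaban1983to89.B12ZetaWitness
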